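import Summits.AtomisticToContinuum.BoseEinsteinCondensation.Theorems.PuffFloor.Negative.FreeGasModel
import Literature.MathematicalPhysics.QuantumManyBody.HardCoreScatteringLength
import HarnessLib

/-!
# `C¹` states of the hard-core gas carry ZERO Cauchy data at contact (why no exact `C¹` minimiser exists; crux `HardCoreExtension`, stmt-AtomisticToContinuum-11786)

Standing adversary of crux `HardCoreExtension` (route `BECConjugateDomination`), gen 3, companion of
`HardCorePositivityVacuity.lean`. The crux must manufacture statements about HARD CORES from the
smooth class; the tree's trial class `PeriodicTrialState` consists of GLOBALLY `C¹` functions. For the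
hard core `v = hardCorePotential a` this has a drastic, kernel-checkable consequence:

* `periodicEnergy_hardCore_eq_top_of_ne_zero_at` — if a state does not vanish at some open-box
  configuration with a pair closer than `a`, its periodic energy is `⊤`;
* `eq_zero_of_close_pair`, `fderiv_eq_zero_of_close_pair` — hence a FINITE-energy state vanishes,
  together with its derivative, on the open contact region `{dist(xᵢ,xⱼ) < a}` of the open box;
* `hardCore_contact_cauchyData` — and, by continuity of `Ψ` and `DΨ` along the inward segment
  `xⱼ ↦ xⱼ + t(xᵢ − xⱼ)`, BOTH `Ψ = 0` and `DΨ = 0` at every CONTACT configuration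
  `dist(xᵢ,xⱼ) ≤ a` of the open box (`kineticDensity_eq_zero_of_contact`).

So in the `C¹` class the hard wall is met with zero Dirichlet AND zero Neumann data. Consequences
(paper, recorded in `Cruxes/HardCoreExtension/Disproof.lean` §10): (i) an exact `C¹` minimiser would be
a Dirichlet eigenfunction of the free region with vanishing Cauchy data on the contact boundary, hence
`≡ 0` by unique continuation — there is NO exact `C¹` minimiser for hard cores (`N ≥ 2`, `E₀ < ⊤`),
and every statement quantifying over exact minimisers is vacuous there; (ii) the true hard-core ground
state has a non-zero normal derivative at contact (Hopf; this boundary layer carries the `4πaρN`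
energy), so `periodicGroundStateEnergy` is an infimum approached only through states whose gradient is
squeezed into an ever thinner layer — the honest objects for class-blind statements are gap-scale
near-minimisers (with capped floors, `NearMinimiserFloorUV.lean`) or the `H¹` form ground state.
No Theses statement is asserted positively. All `[folklore]`.
-/

noncomputable section

namespace Summit.AtomisticToContinuum.BoseEinsteinCondensation.Theorems.HardCoreExtension.Negative

open Literature.MathematicalPhysics.QuantumManyBody.BoseGas MeasureTheory Filter Metric Topology
open Summit.AtomisticToContinuum.BoseEinsteinCondensation.Theorems.PuffFloor.Negative
  (openBoxN isOpen_openBoxN openBoxN_subset_cellN)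
open scoped ENNReal NNReal Topology

variable {N : ℕ} {L a : ℝ}

/-- The pair term `v(|xᵢ − xⱼ|)`, `i < j`, is a lower bound for the interaction. [folklore] -/
theorem le_interaction' (v : ℝ → ℝ≥0∞) {i j : Fin N} (hij : i < j) (X : Config N) :
    v (dist (X i) (X j)) ≤ interaction v X := by
  unfold interaction
  refine le_trans ?_ (Finset.single_le_sum
    (f := fun i' : Fin N => ∑ j' ∈ Finset.univ.filter (fun j' => i' < j'), v (dist (X i') (X j')))
    (fun _ _ => bot_le) (Finset.mem_univ i))
  exact Finset.single_le_sum (f := fun j' : Fin N => v (dist (X i) (X j')))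
    (fun _ _ => bot_le) (Finset.mem_filter.2 ⟨Finset.mem_univ j, hij⟩)

/-- **Infinite energy from a non-zero value near contact.** If a periodic trial state of the
hard-core gas (`v = hardCorePotential a`) does not vanish at an open-box configuration `X₀` with
`dist(xᵢ,xⱼ) < a` for some `i < j`, then `periodicEnergy v Ψ = ⊤`. [folklore] -/
theorem periodicEnergy_hardCore_eq_top_of_ne_zero_at (Ψ : PeriodicTrialState N L) {i j : Fin N}
    (hij : i < j) {X₀ : Config N} (hX₀ : X₀ ∈ openBoxN N L) (hclose : dist (X₀ i) (X₀ j) < a)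
    (hΨ : Ψ.ψ X₀ ≠ 0) : periodicEnergy (hardCorePotential a) Ψ = ⊤ := by
  set U : Set (Config N) :=
    {X | dist (X i) (X j) < a} ∩ ({X | Ψ.ψ X ≠ 0} ∩ openBoxN N L) with hU
  have hcont : Continuous Ψ.ψ := Ψ.contDiff.continuous
  have hUo : IsOpen U := by
    refine IsOpen.inter ?_ ((isOpen_ne_fun hcont continuous_const).inter (isOpen_openBoxN N L))
    exact isOpen_lt (by fun_prop) continuous_const
  have hX₀U : X₀ ∈ U := ⟨hclose, hΨ, hX₀⟩
  have hUpos : volume U ≠ 0 := (hUo.measure_pos volume ⟨_, hX₀U⟩).ne'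
  have hUcell : U ⊆ cellN N L := fun X hX => openBoxN_subset_cellN N L hX.2.2
  have htop : ∀ X ∈ U, (⊤ : ℝ≥0∞) ≤
      kineticDensity Ψ.ψ X +
        periodicInteraction (hardCorePotential a) L X * ((‖Ψ.ψ X‖₊ : ℝ≥0∞)) ^ 2 := by
    intro X hX
    have h1 : periodicInteraction (hardCorePotential a) L X = ⊤ := by
      refine eq_top_iff.2 ?_
      calc (⊤ : ℝ≥0∞) = hardCorePotential a (dist (X i) (X j)) := (hardCorePotential_of_lt hX.1).symm
        _ ≤ interaction (hardCorePotential a) X := le_interaction' _ hij X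
        _ ≤ periodicInteraction (hardCorePotential a) L X := interaction_le_periodicInteraction _ L X
    have h2 : ((‖Ψ.ψ X‖₊ : ℝ≥0∞)) ^ 2 ≠ 0 := by
      have : (‖Ψ.ψ X‖₊ : ℝ≥0∞) ≠ 0 := by
        rw [Ne, ENNReal.coe_eq_zero, nnnorm_eq_zero]; exact hX.2.1
      exact pow_ne_zero 2 this
    rw [h1, ENNReal.top_mul h2]
    exact le_add_self
  refine eq_top_iff.2 ?_
  calc (⊤ : ℝ≥0∞) = ⊤ * volume U := (ENNReal.top_mul hUpos).symm
    _ = ∫⁻ _ in U, (⊤ : ℝ≥0∞) := (setLIntegral_const U ⊤).symm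
    _ ≤ ∫⁻ X in U, kineticDensity Ψ.ψ X +
          periodicInteraction (hardCorePotential a) L X * ((‖Ψ.ψ X‖₊ : ℝ≥0∞)) ^ 2 :=
        setLIntegral_mono' hUo.measurableSet htop
    _ ≤ periodicEnergy (hardCorePotential a) Ψ := lintegral_mono_set hUcell

/-- **Finite energy ⇒ zero on the open contact region.** [folklore] -/
theorem eq_zero_of_close_pair (Ψ : PeriodicTrialState N L)
    (hE : periodicEnergy (hardCorePotential a) Ψ ≠ ⊤) {i j : Fin N} (hij : i < j) {X : Config N}
    (hX : X ∈ openBoxN N L) (hclose : dist (X i) (X j) < a) : Ψ.ψ X = 0 := by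
  by_contra h
  exact hE (periodicEnergy_hardCore_eq_top_of_ne_zero_at Ψ hij hX hclose h)

/-- **Finite energy ⇒ zero DERIVATIVE on the open contact region** (the state vanishes on an open
neighbourhood). [folklore] -/
theorem fderiv_eq_zero_of_close_pair (Ψ : PeriodicTrialState N L)
    (hE : periodicEnergy (hardCorePotential a) Ψ ≠ ⊤) {i j : Fin N} (hij : i < j) {X : Config N}
    (hX : X ∈ openBoxN N L) (hclose : dist (X i) (X j) < a) : fderiv ℝ Ψ.ψ X = 0 := by
  have hV : ({Y : Config N | dist (Y i) (Y j) < a} ∩ openBoxN N L) ∈ 𝓝 X :=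
    ((isOpen_lt (by fun_prop) continuous_const).inter (isOpen_openBoxN N L)).mem_nhds ⟨hclose, hX⟩
  have hEq : Ψ.ψ =ᶠ[𝓝 X] fun _ => (0 : ℂ) :=
    Filter.eventually_of_mem hV fun Y hY => eq_zero_of_close_pair Ψ hE hij hY.2 hY.1
  rw [hEq.fderiv_eq]
  exact fderiv_const_apply 0

/-- **Zero Cauchy data at contact.** For a finite-energy `C¹` state of the hard-core gas, at every
open-box configuration with a pair at distance `≤ a` (in particular AT contact, `dist = a`) both the
state and its full derivative vanish: along the inward segment `xⱼ ↦ xⱼ + t(xᵢ − xⱼ)`, `t ↓ 0`, the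
configuration stays in the open box with the pair strictly closer than `a`, and `Ψ`, `DΨ` are
continuous. [folklore] -/
theorem hardCore_contact_cauchyData (ha : 0 < a) (Ψ : PeriodicTrialState N L)
    (hE : periodicEnergy (hardCorePotential a) Ψ ≠ ⊤) {i j : Fin N} (hij : i < j) {X : Config N}
    (hX : X ∈ openBoxN N L) (hcontact : dist (X i) (X j) ≤ a) :
    Ψ.ψ X = 0 ∧ fderiv ℝ Ψ.ψ X = 0 := by
  have hne : i ≠ j := hij.ne
  -- the inward segment
  set Y : ℝ → Config N := fun t => Function.update X j (X j + t • (X i - X j)) with hY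
  have hYc : Continuous Y :=
    continuous_const.update j (continuous_const.add (continuous_id.smul continuous_const))
  have hY0 : Y 0 = X := by simp [hY]
  have hYi : ∀ t, Y t i = X i := fun t => by simp [hY, Function.update_of_ne hne]
  have hYj : ∀ t, Y t j = X j + t • (X i - X j) := fun t => by simp [hY]
  have hdist : ∀ t, dist (Y t i) (Y t j) = |1 - t| * dist (X i) (X j) := by
    intro t
    rw [hYi, hYj, dist_eq_norm, dist_eq_norm,
      show X i - (X j + t • (X i - X j)) = (1 - t) • (X i - X j) by
        rw [sub_smul, one_smul]; abel,
      norm_smul, Real.norm_eq_abs]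
  -- for small `t > 0` the segment lies in the open box with the pair strictly closer than `a`
  have hnhds : Y ⁻¹' openBoxN N L ∈ 𝓝 (0 : ℝ) :=
    (isOpen_openBoxN N L).preimage hYc |>.mem_nhds (by rw [Set.mem_preimage, hY0]; exact hX)
  obtain ⟨t₀, ht₀, hball⟩ := Metric.mem_nhds_iff.1 hnhds
  have hin : ∀ t ∈ Set.Ioo (0 : ℝ) (min t₀ 1), Y t ∈ openBoxN N L ∧ dist (Y t i) (Y t j) < a := by
    intro t ht
    have ht0 : 0 < t := ht.1
    have ht1 : t < t₀ := lt_of_lt_of_le ht.2 (min_le_left _ _)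
    have ht2 : t < 1 := lt_of_lt_of_le ht.2 (min_le_right _ _)
    refine ⟨hball ?_, ?_⟩
    · rw [Metric.mem_ball, Real.dist_eq, sub_zero, abs_of_pos ht0]; exact ht1
    · rw [hdist, abs_of_pos (by linarith)]
      have hd0 : 0 ≤ dist (X i) (X j) := dist_nonneg
      calc (1 - t) * dist (X i) (X j) ≤ (1 - t) * a :=
            mul_le_mul_of_nonneg_left hcontact (by linarith)
        _ < a := by nlinarith
  have hm0 : 0 < min t₀ 1 := lt_min ht₀ one_pos
  have h0mem : (0 : ℝ) ∈ closure (Set.Ioo (0 : ℝ) (min t₀ 1)) := by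
    rw [closure_Ioo hm0.ne]; exact ⟨le_rfl, hm0.le⟩
  constructor
  · -- the value
    have hcont : Continuous fun t : ℝ => Ψ.ψ (Y t) := Ψ.contDiff.continuous.comp hYc
    have hEq : Set.EqOn (fun t : ℝ => Ψ.ψ (Y t)) (fun _ => (0 : ℂ)) (Set.Ioo 0 (min t₀ 1)) :=
      fun t ht => eq_zero_of_close_pair Ψ hE hij (hin t ht).1 (hin t ht).2
    have h := hEq.closure hcont continuous_const h0mem
    simpa [hY0] using h
  · -- the derivative
    have hcont : Continuous fun t : ℝ => fderiv ℝ Ψ.ψ (Y t) :=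
      (Ψ.contDiff.continuous_fderiv one_ne_zero).comp hYc
    have hEq : Set.EqOn (fun t : ℝ => fderiv ℝ Ψ.ψ (Y t)) (fun _ => (0 : Config N →L[ℝ] ℂ))
        (Set.Ioo 0 (min t₀ 1)) :=
      fun t ht => fderiv_eq_zero_of_close_pair Ψ hE hij (hin t ht).1 (hin t ht).2
    have h := hEq.closure hcont continuous_const h0mem
    simpa [hY0] using h

/-- In particular the kinetic energy density of a finite-energy state vanishes at every contact
configuration of the open box: in the `C¹` class the hard wall carries no boundary layer. [folklore] -/
theorem kineticDensity_eq_zero_of_contact (ha : 0 < a) (Ψ : PeriodicTrialState N L)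
    (hE : periodicEnergy (hardCorePotential a) Ψ ≠ ⊤) {i j : Fin N} (hij : i < j) {X : Config N}
    (hX : X ∈ openBoxN N L) (hcontact : dist (X i) (X j) ≤ a) : kineticDensity Ψ.ψ X = 0 := by
  have h := (hardCore_contact_cauchyData ha Ψ hE hij hX hcontact).2
  simp [kineticDensity, h]

end Summit.AtomisticToContinuum.BoseEinsteinCondensation.Theorems.HardCoreExtension.Negative

end
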